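import Summits.KontsevichZagierPeriods.KontsevichZagierPeriods.Theses.HurwitzMicroSectors
import Summits.KontsevichZagierPeriods.KontsevichZagierPeriods.Theorems.SectorTwoSix.Negative.LoadBearing
import Literature.NumberTheory.Transcendental.KZLogCalculusProofs
import Literature.NumberTheory.Transcendental.KZRelationsLE

/-!
# `SectorTwoSix` (stmt-KontsevichZagierPeriods-3870, route HurwitzMicroSectors) — line
`jacobian-monomial-absorption`, stub `stub_reduce`

The REDUCTION half of the crux on the canonical sector representations
`sectorRep P = [box, P(t)/(1−t⁶)]` (`t = x₀x₁`, `box = (0,1)²`, landed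
`Theorems/SectorTwoSix/Negative/LoadBearing.lean`): from the single-move targets (taken as
HYPOTHESES — they are the neighbouring stub `stub_targets`)

* monomial evaluation `[(tᵏ − tᵏ⁺⁶)/(1−t⁶)] ∼ [(k+1)⁻²(1−t⁶)/(1−t⁶)]`,
* `m = 2` dilations `[4t²ˢ⁺¹/(1−t⁶)] ∼ [(tˢ + tˢ⁺³)/(1−t⁶)]`,
* `m = 3` dilations `[9t³ˢ⁺²/(1−t⁶)] ∼ [(tˢ + tˢ⁺² + tˢ⁺⁴)/(1−t⁶)]`,

every numerator `P ∈ ℚ[t]` is KZ-equivalent to a NORMAL FORM `a(1−t⁶) + bt³ + ct⁵`, `a b c ∈ ℚ`.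

Architecture (def-free port of the tree work file `Cruxes/SectorTwoSix/Disproof.lean` §6): the
syzygy set `K = {D ∈ ℚ[t] | [box, D(t)/(1−t⁶)] ∈ KZ.relations}` is closed under `+` (ONE instance of
rule 1b, integrand additivity: `of_sectorRep_add_mem`) and under `D ↦ C c · D`, `c ∈ ℚ` (the
tree's scaling endomorphism `KZ.scale`, `KZ.scale_mem_relations`: rational rescaling happens INSIDE
the integrands, no "division rule" is needed), so it is a `ℚ`-subspace; the targets put the five
generator polynomials `4t²ˢ⁺¹ − tˢ − tˢ⁺³` (`s = 0,1,2`), `9t⁵ − t − t³ − t⁵`,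
`tᵏ − tᵏ⁺⁶ − (k+1)⁻²(1−t⁶)` in `K`; the six residues `t⁰,…,t⁵` reduce to `ℚt³ + ℚt⁵` by explicit
`ℚ`-combinations of the first four (`1 ≡ −5t³ + 32t⁵`, `t ≡ −t³ + 8t⁵`, `t² ≡ 3t⁵`, `t⁴ ≡ 5t³ − 8t⁵`),
higher monomials by the shift, general `P` by linearity (`Polynomial.induction_on'`).
[Kontsevich–Zagier 2001, §1.2, rules (1), (2); Milnor 1983 / Lang 1990 Ch. 2 (distribution relations)]
-/

noncomputable section

open Set MeasureTheory Polynomial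
open Literature.NumberTheory.Transcendental
open Summit.KontsevichZagierPeriods.Theorems.SectorTwoSix.Negative

namespace Summit.KontsevichZagierPeriods.Theorems.HurwitzMicroSectorsSectorTwoSix

/-! ## The syzygy set `K = {D | [box, D/(1−t⁶)] ∈ relations}` is a `ℚ`-subspace -/

/-- `0 ∈ K`: the zero numerator is a relation. [folklore] -/
theorem of_sectorRep_zero_mem : KZ.of (sectorRep 0) ∈ KZ.relations :=
  KZ.of_mem_relations_of_eqOn_zero _ fun x _ => by simp [sectorFun]

/-- `K` is closed under addition. [Kontsevich–Zagier 2001, §1.2, rule (1)] -/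
theorem of_sectorRep_add_mem {P Q : ℚ[X]} (hP : KZ.of (sectorRep P) ∈ KZ.relations)
    (hQ : KZ.of (sectorRep Q) ∈ KZ.relations) : KZ.of (sectorRep (P + Q)) ∈ KZ.relations := by
  -- rule 1b: `[P + Q] − [P] − [Q]` is ONE integrand-additivity move
  have h : KZ.of (sectorRep (P + Q)) - KZ.of (sectorRep P) - KZ.of (sectorRep Q) ∈ KZ.relations :=
    KZ.integrandAddRel_subset_relations ⟨2, sectorRep (P + Q), sectorRep P, sectorRep Q, rfl, rfl,
      fun x _ => by simp [sectorFun, add_div], rfl⟩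
  have : KZ.of (sectorRep (P + Q)) =
      (KZ.of (sectorRep (P + Q)) - KZ.of (sectorRep P) - KZ.of (sectorRep Q)) +
        KZ.of (sectorRep P) + KZ.of (sectorRep Q) := by abel
  rw [this]
  exact KZ.relations.add_mem (KZ.relations.add_mem h hP) hQ

/-- `K` is closed under rational rescaling `D ↦ C c · D`: the tree's scaling endomorphism
`KZ.scale c` preserves `relations`, and `[box, cD/(1−t⁶)]` agrees on the box with the rescaled
representation (rule 1b congruence). No division happens in `FormalRep`. [Kontsevich–Zagier 2001, §1.2] -/
theorem of_sectorRep_C_mul_mem (c : ℚ) {D : ℚ[X]} (hD : KZ.of (sectorRep D) ∈ KZ.relations) :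
    KZ.of (sectorRep (C c * D)) ∈ KZ.relations := by
  -- a rational constant is algebraic over `ℚ` (KZ §1.1: "rational" may be replaced by "algebraic")
  have hc : IsAlgebraic ℚ ((c : ℚ) : ℝ) := by
    simpa using isAlgebraic_algebraMap (R := ℚ) (A := ℝ) c
  have h1 : KZ.scale (c : ℝ) hc (KZ.of (sectorRep D)) ∈ KZ.relations :=
    KZ.scale_mem_relations _ _ hD
  rw [KZ.scale_of] at h1
  have h2 : KZ.of (sectorRep (C c * D)) -
      KZ.of ((sectorRep D).constMul (c : ℝ) hc) ∈ KZ.relations := by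
    refine KZ.of_sub_of_mem_relations_of_eqOn rfl fun x _ => ?_
    simp only [sectorRep_integrand, KZ.IntegralRep.integrand_constMul, sectorFun, map_mul,
      Polynomial.aeval_C, eq_ratCast, mul_div_assoc]
  have : KZ.of (sectorRep (C c * D)) = (KZ.of (sectorRep (C c * D)) -
      KZ.of ((sectorRep D).constMul (c : ℝ) hc)) + KZ.of ((sectorRep D).constMul (c : ℝ) hc) := by
    abel
  rw [this]
  exact KZ.relations.add_mem h2 h1

/-- `K` is closed under negation. [folklore] -/
theorem of_sectorRep_neg_mem {D : ℚ[X]} (hD : KZ.of (sectorRep D) ∈ KZ.relations) :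
    KZ.of (sectorRep (-D)) ∈ KZ.relations := by
  have h := of_sectorRep_C_mul_mem (-1) hD
  rwa [map_neg, map_one, neg_one_mul] at h

/-- `K` is closed under subtraction. [folklore] -/
theorem of_sectorRep_sub_mem {P Q : ℚ[X]} (hP : KZ.of (sectorRep P) ∈ KZ.relations)
    (hQ : KZ.of (sectorRep Q) ∈ KZ.relations) : KZ.of (sectorRep (P - Q)) ∈ KZ.relations := by
  rw [sub_eq_add_neg]
  exact of_sectorRep_add_mem hP (of_sectorRep_neg_mem hQ)

/-- From an equivalence `[P] ∼ [Q]` to the syzygy `P − Q ∈ K`. [Kontsevich–Zagier 2001, §1.2, rule (1)] -/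
theorem of_sectorRep_sub_mem_of_sub_mem {P Q : ℚ[X]}
    (h : KZ.of (sectorRep P) - KZ.of (sectorRep Q) ∈ KZ.relations) :
    KZ.of (sectorRep (P - Q)) ∈ KZ.relations := by
  -- rule 1b: `[P] − [P − Q] − [Q]` is ONE integrand-additivity move
  have hadd : KZ.of (sectorRep P) - KZ.of (sectorRep (P - Q)) - KZ.of (sectorRep Q) ∈ KZ.relations :=
    KZ.integrandAddRel_subset_relations ⟨2, sectorRep P, sectorRep (P - Q), sectorRep Q, rfl, rfl,
      fun x _ => by simp [sectorFun, sub_div], rfl⟩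
  have : KZ.of (sectorRep (P - Q)) = (KZ.of (sectorRep P) - KZ.of (sectorRep Q)) -
      (KZ.of (sectorRep P) - KZ.of (sectorRep (P - Q)) - KZ.of (sectorRep Q)) := by abel
  rw [this]
  exact KZ.relations.sub_mem h hadd

/-- From the syzygy `P − Q ∈ K` to the equivalence `[P] ∼ [Q]`. [Kontsevich–Zagier 2001, §1.2, rule (1)] -/
theorem sub_mem_of_of_sectorRep_sub_mem {P Q : ℚ[X]}
    (h : KZ.of (sectorRep (P - Q)) ∈ KZ.relations) :
    KZ.of (sectorRep P) - KZ.of (sectorRep Q) ∈ KZ.relations := by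
  have hadd : KZ.of (sectorRep P) - KZ.of (sectorRep (P - Q)) - KZ.of (sectorRep Q) ∈ KZ.relations :=
    KZ.integrandAddRel_subset_relations ⟨2, sectorRep P, sectorRep (P - Q), sectorRep Q, rfl, rfl,
      fun x _ => by simp [sectorFun, sub_div], rfl⟩
  have : KZ.of (sectorRep P) - KZ.of (sectorRep Q) =
      (KZ.of (sectorRep P) - KZ.of (sectorRep (P - Q)) - KZ.of (sectorRep Q)) +
        KZ.of (sectorRep (P - Q)) := by abel
  rw [this]
  exact KZ.relations.add_mem hadd h

/-! ## Reduction of the monomials `tᵏ` -/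

/-- **Monomial reduction.** From the targets, every `tᵏ` is congruent modulo `K` to a normal form
`a(1−t⁶) + bt³ + ct⁵`: the six residues by the four distribution generators
(`t² − 3t⁵ = −g₂(2)`, `t + t³ − 8t⁵ = −g₃(1)`, `1 + 5t³ − 32t⁵ = −g₂(0) − 4g₃(1)`,
`t⁴ − 5t³ + 8t⁵ = g₃(1) − g₂(1)`, where `g₂(s) = 4t²ˢ⁺¹ − tˢ − tˢ⁺³`, `g₃(1) = 9t⁵ − t − t³ − t⁵`),
then the shift `tᵏ⁺⁶ ≡ tᵏ − (k+1)⁻²(1−t⁶)`. [Milnor 1983; Lang 1990, Ch. 2 §8–10] -/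
theorem exists_X_pow_sub_nf_mem
    (hM : ∀ k : ℕ, KZ.of (sectorRep (X ^ k - X ^ (k + 6))) -
        KZ.of (sectorRep (C (1 / ((k : ℚ) + 1) ^ 2) * (1 - X ^ 6))) ∈ KZ.relations)
    (h2 : ∀ s : ℕ, KZ.of (sectorRep (4 * X ^ (2 * s + 1))) -
        KZ.of (sectorRep (X ^ s + X ^ (s + 3))) ∈ KZ.relations)
    (h3 : ∀ s : ℕ, KZ.of (sectorRep (9 * X ^ (3 * s + 2))) -
        KZ.of (sectorRep (X ^ s + X ^ (s + 2) + X ^ (s + 4))) ∈ KZ.relations) (k : ℕ) :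
    ∃ a b c : ℚ, KZ.of (sectorRep (X ^ k - (C a * (1 - X ^ 6) + C b * X ^ 3 + C c * X ^ 5))) ∈
      KZ.relations := by
  -- the four generators actually used, as members of `K`
  have g20 : KZ.of (sectorRep (4 * X ^ 1 - (X ^ 0 + X ^ 3) : ℚ[X])) ∈ KZ.relations :=
    of_sectorRep_sub_mem_of_sub_mem (by simpa using h2 0)
  have g21 : KZ.of (sectorRep (4 * X ^ 3 - (X ^ 1 + X ^ 4) : ℚ[X])) ∈ KZ.relations :=
    of_sectorRep_sub_mem_of_sub_mem (by simpa using h2 1)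
  have g22 : KZ.of (sectorRep (4 * X ^ 5 - (X ^ 2 + X ^ 5) : ℚ[X])) ∈ KZ.relations :=
    of_sectorRep_sub_mem_of_sub_mem (by simpa using h2 2)
  have g31 : KZ.of (sectorRep (9 * X ^ 5 - (X ^ 1 + X ^ 3 + X ^ 5) : ℚ[X])) ∈ KZ.relations :=
    of_sectorRep_sub_mem_of_sub_mem (by simpa using h3 1)
  induction k using Nat.strong_induction_on with
  | _ k ih =>
    rcases Nat.lt_or_ge k 6 with hk | hk
    · interval_cases k
      · -- `1 − (−5t³ + 32t⁵) = −g₂(0) − 4·g₃(1)`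
        refine ⟨0, -5, 32, ?_⟩
        have h := of_sectorRep_sub_mem (of_sectorRep_neg_mem g20) (of_sectorRep_C_mul_mem 4 g31)
        convert h using 3
        simp only [map_zero, map_neg, map_ofNat]
        ring
      · -- `t − (−t³ + 8t⁵) = −g₃(1)`
        refine ⟨0, -1, 8, ?_⟩
        have h := of_sectorRep_neg_mem g31
        convert h using 3
        simp only [map_zero, map_neg, map_one, map_ofNat]
        ring
      · -- `t² − 3t⁵ = −g₂(2)`
        refine ⟨0, 0, 3, ?_⟩
        have h := of_sectorRep_neg_mem g22
        convert h using 3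
        simp only [map_zero, map_ofNat]
        ring
      · -- `t³ − t³ = 0`
        refine ⟨0, 1, 0, ?_⟩
        convert of_sectorRep_zero_mem using 3
        simp only [map_zero, map_one]
        ring
      · -- `t⁴ − (5t³ − 8t⁵) = g₃(1) − g₂(1)`
        refine ⟨0, 5, -8, ?_⟩
        have h := of_sectorRep_sub_mem g31 g21
        convert h using 3
        simp only [map_zero, map_neg, map_ofNat]
        ring
      · -- `t⁵ − t⁵ = 0`
        refine ⟨0, 0, 1, ?_⟩
        convert of_sectorRep_zero_mem using 3
        simp only [map_zero, map_one]
        ring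
    · -- shift: `tʲ⁺⁶ − nf(a − q, b, c) = (tʲ − nf(a,b,c)) − (tʲ − tʲ⁺⁶ − q(1−t⁶))`, `q = (j+1)⁻²`
      obtain ⟨j, rfl⟩ := Nat.exists_eq_add_of_le' hk
      obtain ⟨a, b, c, hj⟩ := ih j (by omega)
      refine ⟨a - 1 / ((j : ℚ) + 1) ^ 2, b, c, ?_⟩
      have hm : KZ.of (sectorRep ((X ^ j - X ^ (j + 6)) - C (1 / ((j : ℚ) + 1) ^ 2) * (1 - X ^ 6))) ∈
          KZ.relations := of_sectorRep_sub_mem_of_sub_mem (hM j)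
      have h := of_sectorRep_sub_mem hj hm
      convert h using 3
      simp only [map_sub]
      ring

/-! ## Reduction of every numerator -/

/-- **Reduction** (registered stub `stub_reduce` of crux stmt-KontsevichZagierPeriods-3870): from
the single-move targets, every numerator `P ∈ ℚ[t]` is KZ-equivalent, as a canonical sector
representation, to a normal form `a(1−t⁶) + bt³ + ct⁵` with `a, b, c ∈ ℚ` (linearity of the
syzygy set over `ℚ` + the monomial reduction). [Kontsevich–Zagier 2001, §1.2; Milnor 1983; Lang 1990] -/
theorem stub_reduce :
    (∀ k : ℕ, KZ.of (sectorRep (X ^ k - X ^ (k + 6))) -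
        KZ.of (sectorRep (C (1 / ((k : ℚ) + 1) ^ 2) * (1 - X ^ 6))) ∈ KZ.relations) →
    (∀ s : ℕ, KZ.of (sectorRep (4 * X ^ (2 * s + 1))) -
        KZ.of (sectorRep (X ^ s + X ^ (s + 3))) ∈ KZ.relations) →
    (∀ s : ℕ, KZ.of (sectorRep (9 * X ^ (3 * s + 2))) -
        KZ.of (sectorRep (X ^ s + X ^ (s + 2) + X ^ (s + 4))) ∈ KZ.relations) →
    ∀ P : ℚ[X], ∃ a b c : ℚ,
      KZ.of (sectorRep P) - KZ.of (sectorRep (C a * (1 - X ^ 6) + C b * X ^ 3 + C c * X ^ 5)) ∈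
        KZ.relations := by
  intro hM h2 h3 P
  suffices h : ∃ a b c : ℚ,
      KZ.of (sectorRep (P - (C a * (1 - X ^ 6) + C b * X ^ 3 + C c * X ^ 5))) ∈ KZ.relations by
    obtain ⟨a, b, c, h⟩ := h
    exact ⟨a, b, c, sub_mem_of_of_sectorRep_sub_mem h⟩
  induction P using Polynomial.induction_on' with
  | add p q hp hq =>
    obtain ⟨a, b, c, hp⟩ := hp
    obtain ⟨a', b', c', hq⟩ := hq
    refine ⟨a + a', b + b', c + c', ?_⟩
    have h := of_sectorRep_add_mem hp hq
    convert h using 3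
    simp only [map_add]
    ring
  | monomial k a =>
    obtain ⟨a₀, b₀, c₀, hk⟩ := exists_X_pow_sub_nf_mem hM h2 h3 k
    refine ⟨a * a₀, a * b₀, a * c₀, ?_⟩
    have h := of_sectorRep_C_mul_mem a hk
    convert h using 3
    simp only [map_mul, ← C_mul_X_pow_eq_monomial]
    ring

end Summit.KontsevichZagierPeriods.Theorems.HurwitzMicroSectorsSectorTwoSix

end
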